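import Literature.AnabelianGeometry.EtaleTheta.Discharge.Sec3LogDivisorTowerCuspSwap
import Literature.AnabelianGeometry.EtaleTheta.LogDivisorModelTateTowerKummerTwistCompatRShearTempered
import Literature.AnabelianGeometry.EtaleTheta.Discharge.Sec3DivisorDataRigidRefutedAtThetaTwistTower
import HarnessLib

/-!
# [EtTh] Def. 3.3 (iii) at `dmSmall`: the CUSP SWAP as a natural family of monoid AUTOMORPHISMS `σ_Y : Φ₀(Y) ≃* Φ₀(Y)` over the
# identity of `CosetCat Compat₃′`, fixing `div₀` and moving an element — plugged into abc-iut-L2-t12's socket: ★ `DivisorDataRigid` is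
# FALSE AS TYPED at the [EtTh] Def. 3.6 carrier of record `temperedFrobenioidSmall` (proof-only)

S. Mochizuki, *The étale theta function and its Frobenioid-theoretic manifestations* [EtTh], Publ. RIMS **45** (2009) (refereed),
Def. 3.3 (iii) pp.299–300 (PDF pp.73–74) («`Φ₀(Y^log) := lim_{→ Z^log_∞} Div⁺(Z^log_∞)^{Gal(Z^log_∞/Y^log)}`», «`B₀ → Φ₀^gp` … by
assigning to a log-meromorphic function its log-divisor of zeroes and poles»), Rmk. 3.3.1 pp.299–300 (PDF pp.73–74), Def. 3.6 pp.302–303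
(PDF pp.76–77) (bib key `MochizukiEtTh2009`; own render `paper:doi-10-2977-prims-1234361159` p0073/p0074; page convention printed N = PDF M + 226).
S. Mochizuki, *The geometry of Frobenioids II* (2008), Ex. 1.3 (i) p.11 (the coset model of `B^temp(Π)⁰`).

PROOF-ONLY rider (0 `def`, 0 `instance`, 0 notation, no new `Prop`; cell abc-iut, block F, seat abc-iut-f-193 gen 15; abc-iut-L2-lead R1469
«¬DDR@CARRIER-OF-RECORD» — abc-iut-L2-t12's SOCKET (STATUS 2026-08-27T12:16:40Z) for this seat's cusp swap ★ `exists_cuspSwap` (p530422);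
every input BY NAME, nothing restated).  Two theorems:
* **`exists_phiZeroCompAut_cuspSwap`** (generic in the level `n` and the `Compat₃′`-set `S`): there is a family of monoid automorphisms
  `σ n S` of `Φ₀ = Hom_{Compat₃′}(S, Div⁺(Z_n))` (post-composition by the cusp swap, via this seat's `comp_mem_phiZero_of_comm`) that is
  NATURAL under every pull-back `phiZeroPull` (`rfl`) and every level transition `transPhi` (⟸ `exists_cuspSwap` (3)), FIXES
  `div₀ = [divNum]/[divDen]` (abc-iut-w6-d058's `divZero_eq_div_iff` + `divAt_mul_divDen` ⟸ `exists_cuspSwap` (4)), and MOVES an element of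
  `Φ₀(Compat₃′/V₀)` over abc-iut-L1-t6's open normal subgroup `V₀ := vOpenNormal 0 ≤ ker γ` (the equivariant family `gV₀ ↦ actDIV g d` of a
  moved effective Cartier divisor `d`, `exists_cuspSwap` (5); well defined because `actDIV` factors through `γ`, `towerC₃sf_actDIV` p528860);
* **`exists_phiZeroAut_cuspSwap`** — the same read on abc-iut-L2-t3's small-indexed Def. 3.3 (iii) data `dmSmall = (ofTower towerC₃sf).precomp
  toConn`, in EXACTLY the binder shapes of abc-iut-L2-t12's socket: `∃ σ : ∀ Y, Φ₀(Y) ≃* Φ₀(Y)`, (hσ) natural under every `dmSmall.Φ₀.map g`,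
  (hfix) `MonGp.map (σ Y) (div₀ b) = div₀ b` for every `b ∈ B₀(Y)`, (hne) a moved element over `equivConn.inverse.obj (toConn.obj V₀)`
  (transported along the unit isomorphism of `CosetCat Compat₃′ ≌ B^temp(Compat₃′)⁰` by naturality).
* ★ **`TemperedFrobenioid.DivisorDataRigidRefutation.not_divisorDataRigid_temperedFrobenioidSmall (R S) :
  ¬ (temperedFrobenioidSmall R S).DivisorDataRigid`** — THE UNCONDITIONAL THEOREM (abc-iut-L2-lead R1477 final-assembly ruling: closed here,
  in abc-iut-L2-t12's namespace): abc-iut-L2-t12's engine/socket ★ p531336 `not_divisorDataRigid_temperedFrobenioidSmall_of_phiZeroAut`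
  (lift through perfection → weak realification to `C.divisorMonoid`, `DataAut` packaging `⟨a := pfImageAut σ, b := id⟩`) ∘ `exists_phiZeroAut_cuspSwap`.
TOKEN (both halves, R1463/R1469 wording): «`DivisorDataRigid` FALSE AS TYPED at OUR carrier of record by cusp relabelling — a DESIGN ARTEFACT
(our `B₀` does not separate cusps; print excludes it: the cusps/zeroes of `Θ̈` are LABELLED, [EtTh] §1 p.244, Prop. 1.4 (i) p.247, Thm. 1.6 (iii)
pp.250–251); γ-translation part: Φ-side exists (★ p528860), no `Div_B`-compatible B-partner (abc-iut-L2-t12 W0); refutable-as-typed-at-a-design-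
carrier ≠ refuted in print; p527197's displayed Prop `DivisorDataRigid` stays a hypothesis of the generic theorem; NO «¬RigidOverBase» claimed».
WHAT IS NOT CLAIMED: nothing about [EtTh] Def. 3.6 / [IUTchI]
Cor. 5.3 in print (labelled cusps exclude the swap there — a DESIGN ARTEFACT of our `B₀`).  HONEST FRAMING: class-(b) design tower;
refutable-as-typed-at-a-design-carrier ≠ refuted in print; no side is taken on [IUTchIII] Cor. 3.12; typed ≠ proved; nothing here bears
on abc itself.
-/

noncomputable section

namespace Literature.AnabelianGeometry.EtaleTheta

open CategoryTheory Opposite Function Literature.AlgebraicGeometry.Frobenioids Literature.AnabelianGeometry.SemiGraphs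

namespace LogDivisorModel.TateTowerThetaTwist

open TateTowerKummerTwistRShear (Grp thetaShear Compat compat levelsC vOpenNormal mem_vSub_iff)
open TateTowerKummerTwist (MuN N eN)
open ThetaTwistTowerSmallIndex LogDivisorTower

/-- **The cusp swap as a family of monoid automorphisms of `Φ₀(S) = Hom_{Compat₃′}(S, Div⁺(Z_n))`, generic in the level `n` and the
`Compat₃′`-set `S`**: natural under every pull-back and every level transition, fixing `div₀ b` for every `b ∈ B₀(S)`, and moving an
element over the open normal subgroup `vOpenNormal 0 ≤ ker γ`. [cite: MochizukiEtTh2009, Def 3.3 (iii) p.299 (PDF p.73)] -/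
theorem exists_phiZeroCompAut_cuspSwap :
    ∃ σ : ∀ (n : ℕ) (S : Action (Type) (Compat 3 thetaShear)), ↥((towerC₃sf.act n).phiZero S) ≃* ↥((towerC₃sf.act n).phiZero S),
      (∀ (n : ℕ) {S S' : Action (Type) (Compat 3 thetaShear)} (f : S ⟶ S') (φ : (towerC₃sf.act n).phiZero S'),
          σ n S ((towerC₃sf.act n).phiZeroPull f φ) = (towerC₃sf.act n).phiZeroPull f (σ n S' φ)) ∧
      (∀ {i j : ℕ} (hij : (levelsC 3 thetaShear).closure j ≤ (levelsC 3 thetaShear).closure i)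
          (S : Action (Type) (Compat 3 thetaShear)) (φ : (towerC₃sf.act i).phiZero S),
          σ j S (towerC₃sf.transPhi hij S φ) = towerC₃sf.transPhi hij S (σ i S φ)) ∧
      (∀ (n : ℕ) (S : Action (Type) (Compat 3 thetaShear)) (b : (towerC₃sf.act n).bZero S),
          MonGp.map (σ n S).toMonoidHom ((towerC₃sf.act n).divZeroHom S b) = (towerC₃sf.act n).divZeroHom S b) ∧
      (∀ n : ℕ, ∃ φ : (towerC₃sf.act n).phiZero (gset (toConn.obj ⟨(vOpenNormal 3 thetaShear 0).toOpenSubgroup⟩)),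
          σ n _ φ ≠ φ) := by
  obtain ⟨τ, hτ, h1, h2, h3, h4, h5⟩ := exists_cuspSwap
  have hinv : ∀ d, τ (τ d) = d := fun d => Multiplicative.toAdd.injective (funext fun x => by
    rw [hτ, hτ]
    rcases x with ⟨j, b⟩ | j <;> simp)
  let σ : ∀ (n : ℕ) (S : Action (Type) (Compat 3 thetaShear)), ↥((towerC₃sf.act n).phiZero S) ≃* ↥((towerC₃sf.act n).phiZero S) :=
    fun n S =>
    { toFun := fun φ => ⟨fun s => τ (φ.1 s), (towerC₃sf.act n).comp_mem_phiZero_of_comm S τ (h2 n) (h1 n) φ⟩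
      invFun := fun φ => ⟨fun s => τ (φ.1 s), (towerC₃sf.act n).comp_mem_phiZero_of_comm S τ (h2 n) (h1 n) φ⟩
      left_inv := fun φ => Subtype.ext (funext fun s => hinv _)
      right_inv := fun φ => Subtype.ext (funext fun s => hinv _)
      map_mul' := fun φ ψ => Subtype.ext (funext fun s => map_mul τ _ _) }
  have hσ : ∀ n S (φ : (towerC₃sf.act n).phiZero S) s, (σ n S φ).1 s = τ (φ.1 s) := fun _ _ _ _ => rfl
  refine ⟨σ, fun n S S' f φ => rfl, fun hij S φ => ?_, fun n S b => ?_, fun n => ?_⟩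
  · exact Subtype.ext (funext fun s => h3 _ _ hij (φ.1 s))
  · rw [LogDivisorModel.GaloisAction.divZeroHom_apply, LogDivisorModel.GaloisAction.divZero, map_div, MonGp.map_of, MonGp.map_of]
    symm
    refine ((towerC₃sf.act n).divZero_eq_div_iff S b _ _).2 fun s => ?_
    rw [MulEquiv.coe_toMonoidHom, hσ, hσ, ← LogDivisorModel.GaloisAction.divAt_mul_divDen]
    have e2 : τ ((towerC₃sf.act n).divAt S b s) = (towerC₃sf.act n).divAt S b s := h4 n ⟨b.1 s, b.2.1 s⟩
    conv_lhs => rw [← e2]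
    exact (map_mul τ _ _).symm
  · obtain ⟨d, hd, hne⟩ := h5 n
    let U : CosetCat (Compat 3 thetaShear) := ⟨(vOpenNormal 3 thetaShear 0).toOpenSubgroup⟩
    have hwd : ∀ a b : Compat 3 thetaShear, (QuotientGroup.leftRel U.sg.toSubgroup) a b →
        (towerC₃sf.act n).actDIV a d = (towerC₃sf.act n).actDIV b d := by
      intro a b hab
      rw [QuotientGroup.leftRel_apply] at hab
      have hγ := ((mem_vSub_iff 3 thetaShear 0 _).1 hab).1
      rw [Subgroup.coe_mul, Subgroup.coe_inv, SemidirectProduct.mul_right, SemidirectProduct.inv_right, Prod.snd_mul,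
        Prod.snd_inv, inv_mul_eq_one] at hγ
      rw [towerC₃sf_actDIV, towerC₃sf_actDIV, hγ]
    let φ : (towerC₃sf.act n).phiZero (gset (toConn.obj U)) :=
      ⟨fun q => Quotient.liftOn' q (fun g => (towerC₃sf.act n).actDIV g d) hwd, fun q => ?_, fun g q => ?_⟩
    rotate_left
    · induction q using QuotientGroup.induction_on with
      | H a => exact (towerC₃sf.act n).actDIV_mem_Divplus a hd
    · induction q using QuotientGroup.induction_on with
      | H a =>
        have hρ : (gset (toConn.obj U)).ρ g (a : Compat 3 thetaShear ⧸ U.sg.toSubgroup) =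
            ((g * a : Compat 3 thetaShear) : Compat 3 thetaShear ⧸ U.sg.toSubgroup) := CosetCat.toBTemp_ρ TateTowerKummerTwistRShear.isTempered_compat₃' U g _
        rw [hρ]
        change (towerC₃sf.act n).actDIV (g * a) d = (towerC₃sf.act n).actDIV g ((towerC₃sf.act n).actDIV a d)
        rw [map_mul, MulAut.mul_apply]
    refine ⟨φ, fun h => hne ?_⟩
    have h1 := congrArg (fun ψ : (towerC₃sf.act n).phiZero (gset (toConn.obj U)) =>
      ψ.1 ((1 : Compat 3 thetaShear) : Compat 3 thetaShear ⧸ U.sg.toSubgroup)) h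
    change τ ((towerC₃sf.act n).actDIV 1 d) = (towerC₃sf.act n).actDIV 1 d at h1
    rwa [map_one, MulAut.one_apply] at h1


/-- **The cusp swap on abc-iut-L2-t3's `dmSmall`, in the binder shapes of abc-iut-L2-t12's socket
`not_divisorDataRigid_temperedFrobenioidSmall_of_phiZeroAut`**: a family `σ_Y : Φ₀(Y) ≃* Φ₀(Y)` over the identity of `CosetCat Compat₃′`,
natural under every `dmSmall.Φ₀.map`, fixing `div₀`, with a moved element over `equivConn.inverse.obj (toConn.obj V₀)`.
[cite: MochizukiEtTh2009, Def 3.3 (iii) p.299 (PDF p.73)] -/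
theorem exists_phiZeroAut_cuspSwap :
    ∃ σ : ∀ Y : (CosetCat (Compat 3 thetaShear))ᵒᵖ, (dmSmall.Φ₀.obj Y : Type) ≃* (dmSmall.Φ₀.obj Y : Type),
      (∀ {Y Y' : (CosetCat (Compat 3 thetaShear))ᵒᵖ} (g : Y ⟶ Y') (x : dmSmall.Φ₀.obj Y),
          σ Y' ((dmSmall.Φ₀.map g).hom x) = (dmSmall.Φ₀.map g).hom (σ Y x)) ∧
      (∀ (Y : (CosetCat (Compat 3 thetaShear))ᵒᵖ) (b : dmSmall.B₀.obj Y),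
          MonGp.map (σ Y).toMonoidHom (dmSmall.div₀ Y b) = dmSmall.div₀ Y b) ∧
      (∃ (A : ConnectedPart (BTemp (Compat 3 thetaShear))) (x : dmSmall.Φ₀.obj (op (equivConn.inverse.obj A))), σ _ x ≠ x) := by
  obtain ⟨σ', hpull, htrans, hfix, hmove⟩ := exists_phiZeroCompAut_cuspSwap
  let σ : ∀ Y : (CosetCat (Compat 3 thetaShear))ᵒᵖ, (dmSmall.Φ₀.obj Y : Type) ≃* (dmSmall.Φ₀.obj Y : Type) := fun Y =>
    σ' ((levelsC 3 thetaShear).lvl (toConn.obj Y.unop)) (gset (toConn.obj Y.unop))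
  have hnat : ∀ {Y Y' : (CosetCat (Compat 3 thetaShear))ᵒᵖ} (g : Y ⟶ Y') (x : dmSmall.Φ₀.obj Y),
      σ Y' ((dmSmall.Φ₀.map g).hom x) = (dmSmall.Φ₀.map g).hom (σ Y x) := by
    intro Y Y' g x
    change σ' _ _ (towerC₃sf.transPhi ((levelsC 3 thetaShear).closure_lvl_mono (toConn.map g.unop)) (gset (toConn.obj Y'.unop))
        ((towerC₃sf.act _).phiZeroPull (toConn.map g.unop).hom.hom x)) =
      towerC₃sf.transPhi ((levelsC 3 thetaShear).closure_lvl_mono (toConn.map g.unop)) (gset (toConn.obj Y'.unop))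
        ((towerC₃sf.act _).phiZeroPull (toConn.map g.unop).hom.hom (σ' _ _ x))
    rw [htrans, hpull]
  refine ⟨σ, hnat, fun Y b => hfix _ _ b, ?_⟩
  -- the moved element over `U := vSub 0`, transported to `equivConn.inverse.obj (toConn.obj U)` along the unit isomorphism
  let U : CosetCat (Compat 3 thetaShear) := ⟨(vOpenNormal 3 thetaShear 0).toOpenSubgroup⟩
  obtain ⟨φ, hφ⟩ := hmove ((levelsC 3 thetaShear).lvl (toConn.obj U))
  let e : U ≅ equivConn.inverse.obj (toConn.obj U) := equivConn.unitIso.app U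
  refine ⟨toConn.obj U, (dmSmall.Φ₀.map e.inv.op).hom φ, fun h => hφ ?_⟩
  have h' := congrArg (fun y => (dmSmall.Φ₀.map e.hom.op).hom y) ((hnat e.inv.op φ).symm.trans h)
  have hcomp : ∀ y : dmSmall.Φ₀.obj (op U), (dmSmall.Φ₀.map e.hom.op).hom ((dmSmall.Φ₀.map e.inv.op).hom y) = y := fun y => by
    have hc : (dmSmall.Φ₀.map e.hom.op).hom.comp (dmSmall.Φ₀.map e.inv.op).hom = MonoidHom.id _ := by
      rw [← CommMonCat.hom_comp, ← Functor.map_comp, ← op_comp, Iso.hom_inv_id, op_id, CategoryTheory.Functor.map_id,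
        CommMonCat.hom_id]
    exact DFunLike.congr_fun hc y
  rw [hcomp, hcomp] at h'
  exact h'

end LogDivisorModel.TateTowerThetaTwist


/-! ## The unconditional theorem at the carrier of record (abc-iut-L2-t12's socket ∘ the cusp swap) -/

namespace TemperedFrobenioid.DivisorDataRigidRefutation

open LogDivisorModel.TateTowerThetaTwist ThetaTwistTowerSmallIndex TateTowerKummerTwistRShear
  Literature.AlgebraicGeometry.Frobenioids.QuasiTemperoid

/-- ★ **`DivisorDataRigid` is FALSE AS TYPED at the [EtTh] Def. 3.6 carrier of record `temperedFrobenioidSmall R S`** (the tempered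
Frobenioid under the §5 count file ★ p522025): abc-iut-L2-t12's engine/socket `not_divisorDataRigid_temperedFrobenioidSmall_of_phiZeroAut`
(★ p531336) applied to the cusp swap `exists_phiZeroAut_cuspSwap`.  HONEST: a DESIGN ARTEFACT of OUR class-(b) carrier — its function monoid
`B₀` does not separate the two cusp `ℤ_γ`-torsors, so relabelling the cusps is a non-trivial automorphism of the Def. 3.6 data `(Φ, B, Div_B)`
over `id_D` with `b := id`; print excludes it (labelled cusps); refutable-as-typed-at-a-design-carrier ≠ refuted in print; the displayed Prop
of ★ p527197 stays a hypothesis of the generic theorem; no «¬RigidOverBase» is claimed. [cite: MochizukiEtTh2009, Def 3.6 p.303 (PDF p.77)] -/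
theorem not_divisorDataRigid_temperedFrobenioidSmall
    (R S : ((ConnectedPart (BTemp (Compat 3 thetaShear)))ᵒᵖ ⥤ CommMonCat.{0}) → Prop) :
    ¬ (temperedFrobenioidSmall R S).DivisorDataRigid := by
  obtain ⟨σ, hσ, hfix, hne⟩ := exists_phiZeroAut_cuspSwap
  exact not_divisorDataRigid_temperedFrobenioidSmall_of_phiZeroAut R S σ hσ hfix hne

end TemperedFrobenioid.DivisorDataRigidRefutation

end Literature.AnabelianGeometry.EtaleTheta

end
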